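import Literature.Computability.AlgebraicComplexity.QuantumFunctionalsUpperKronecker
import Literature.NumberTheory.DiophantineGeometry.SymmetricGroupRepsIrreducibleProofs
import Literature.Probability.Entropy.FiniteShannon
import Mathlib.Data.Fin.Tuple.Sort
import HarnessLib

/-!
# Discharge of CVZ Lemma 3.10.1: `g_{λ,μ,ν} ≠ 0 ⇒ H(λ̄) ≤ H(μ̄) + H(ν̄)`

Topic `Literature/Computability/AlgebraicComplexity`; proofs file for the named fact
`ChristandlVranaZuiddam2023_entropy_le_of_kroneckerCoeff` of `QuantumFunctionalsUpperKronecker.lean`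
(Christandl–Vrana–Zuiddam, *Universal points in the asymptotic spectrum of tensors*, J. Amer. Math.
Soc. 36 (2023) = arXiv:1709.07851v3, Lemma 3.10, first item, p. 13: "Let `λ, μ, ν` be integer
partitions. If `g_{λ,μ,ν}` is nonzero, then `H(λ̄) ≤ H(μ̄) + H(ν̄)`"; the Kronecker coefficient of
Def. 3.8 — the multiplicity of `[λ]` in `[μ] ⊗ [ν]` — is the tree's
`kroneckerCoeff ℂ μ ν λ = dim Hom_{S_n}(S^μ ⊗ S^ν, S^λ)` of `SymmetricGroupReps.lean`, and `H(λ̄)`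
is `partitionEntropy λ`).
Main result: `ChristandlVranaZuiddam2023_entropy_le_of_kroneckerCoeff_holds`.
Everything in this file is PROVED; no named facts are introduced.

## The proof

The printed proof (p. 13) uses the semigroup property of the Kronecker coefficients (Rem. 3.9,
Christandl–Harrow–Mitchison) to pass to `g_{Nλ,Nμ,Nν} ≠ 0`, hence `dim[Nλ] ≤ dim[Nμ] dim[Nν]`, and
the hook-length estimates (Rem. 3.7) as `N → ∞`. The semigroup property is a theorem of geometric
invariant theory far beyond the tree; we give instead the elementary weight argument, entirely on
the `S_n` side and on top of the tree's Young-symmetrizer theory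
(`SymmetricGroupReps*`, `SchurWeylHighestWeightProofs`):

1. (§3) `g_{λ,μ,ν} ≠ 0` gives a nonzero `f ∈ Hom_{S_n}(S^μ ⊗ S^ν, S^λ)`; since `S^μ = ℂ[S_n] c_μ` is
   spanned by the `σ c_μ`, `w = f((σ c_μ) ⊗ (τ c_ν)) ≠ 0` for some `σ, τ`
   (`exists_intertwiningMap_tmul_ne_zero`). As `p c_μ = c_μ` for `p` in the row group `R_μ`, the
   vector `w ∈ S^λ = ℂ[S_n] a_λ b_λ` is fixed by the Young subgroup `H = σR_μσ⁻¹ ∩ τR_ντ⁻¹` of the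
   common refinement `A = (A_{ik})` of the row partitions of `σT_μ` and `τT_ν` — a contingency table
   with row margins `μ` and column margins `ν`. Pick `g` in the support of `w`. The sign trick of
   Fulton–Harris Lemma 4.23 (`colOf_ne_of_of_swap_mul_eq`: `(x y) w = w`, `w · g⁻¹(x y)g = -w` would
   give `w_g = -w_g`) shows that no two elements of a block of `H` lie in one column of `gT_λ`, i.e.
   the block word is *column-strict* for `λ` (`exists_colStrict_blockWord`).
2. (§2) A column-strict word has its `p` largest fibres of total size `≤ λ₁ + ⋯ + λ_p` for every
   `p` (the tree's `lowCount_le_of_isColStrict`, after sorting the fibres by size with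
   `Tuple.sort`): the block sizes `A` are dominated by `λ`. Schur concavity of the Shannon entropy
   along the dominance order (§1, Karamata's inequality for `φ(x) = -x log x`, proved by the
   tangent-line inequality and Abel summation) gives `H(λ̄) ≤ H(Ā)`
   (`wordEnt_rowOf_le_of_colStrict`).
3. (§4) Subadditivity of the Shannon entropy
   (`Literature.Probability.Entropy.FiniteShannon.ent_pair_le_add`) gives `H(Ā) ≤ H(μ̄) + H(ν̄)`,
   the two marginal words of the block word being the row words of `μ` and `ν` up to a
   permutation of the positions.

Entropies are computed in nats as `FiniteShannon.ent` with unit weights of words `Fin n → α` on the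
uniform space `Fin n` (the "word entropy" `ent univ (fun _ => 1) X` of the lemma names
`wordEnt_*`); `partitionEntropy λ = ent univ 1 rowOf_λ / log 2` (`partitionEntropy_eq_wordEnt_div`),
so the factor `log 2` cancels. The file introduces no definitions and no named facts.

## References

* M. Christandl, P. Vrana, J. Zuiddam, J. Amer. Math. Soc. 36 (2023) 31–79 = arXiv:1709.07851v3,
  §3.1, Def. 3.8, Rem. 3.7, Rem. 3.9, Lemma 3.10 (p. 13). [ChristandlVranaZuiddam2023]
* W. Fulton, J. Harris, *Representation Theory. A First Course*, GTM 129, §4.2, Lemma 4.21 and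
  Lemma 4.23 (the sign trick and the dominance lemma behind `exists_colStrict_blockWord`).
  [FultonHarrisGTM129]

## What is NOT here

No semigroup property, no hook-length asymptotics (the printed route), and no statement about
Littlewood–Richardson coefficients (Lemma 3.10, second item).
-/

noncomputable section

open scoped BigOperators TensorProduct
open Real (negMulLog)

namespace Literature.Computability.AlgebraicComplexity

open Literature.NumberTheory.DiophantineGeometry
open Literature.Probability.Entropy.FiniteShannon (ent prob mass ent_pair_le_add ent_comp_of_injOn
  ent_eq_sum_of_subset prob_def mass_def)

/-! ## §1 Karamata's inequality for `φ(x) = -x log x` along the dominance order -/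

section Karamata

/-- Tangent-line inequality for the concave function `φ(x) = -x log x` at a point `y > 0`:
`φ(x) ≤ φ(y) + φ'(y) (x - y)` with `φ'(y) = -log y - 1`, for `x ≥ 0`
(equivalently `x log (y/x) ≤ y - x`, i.e. `log u ≤ u - 1`). [folklore] -/
theorem negMulLog_le_add_mul_sub {x y : ℝ} (hx : 0 ≤ x) (hy : 0 < y) :
    negMulLog x ≤ negMulLog y + (-Real.log y - 1) * (x - y) := by
  rcases hx.eq_or_lt with rfl | hx'
  · have : negMulLog y + (-Real.log y - 1) * (0 - y) = y := by
      rw [Real.negMulLog]; ring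
    rw [Real.negMulLog_zero, this]
    exact hy.le
  · have h := Real.log_le_sub_one_of_pos (div_pos hy hx')
    rw [Real.log_div hy.ne' hx'.ne'] at h
    have h2 : x * (Real.log y - Real.log x) ≤ x * (y / x - 1) :=
      mul_le_mul_of_nonneg_left h hx
    rw [mul_sub, mul_sub, mul_one, mul_div_cancel₀ _ hx'.ne'] at h2
    rw [Real.negMulLog, Real.negMulLog]
    nlinarith [h2]

/-- Abel summation step of Karamata's inequality: if the slopes `s₀ ≤ s₁ ≤ ⋯ ≤ s_{M-1}` are
nondecreasing and the partial sums `D_p = ∑_{k<p} (x_k - y_k)` are nonnegative with `D_M = 0`,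
then `∑_{k<M} s_k (x_k - y_k) ≤ 0`. [folklore] -/
theorem sum_mul_sub_nonpos_of_monotone (s x y : ℕ → ℝ) (M : ℕ)
    (hs : ∀ k, k + 1 < M → s k ≤ s (k + 1))
    (hD : ∀ p ≤ M, 0 ≤ ∑ k ∈ Finset.range p, (x k - y k))
    (hDM : ∑ k ∈ Finset.range M, (x k - y k) = 0) :
    ∑ k ∈ Finset.range M, s k * (x k - y k) ≤ 0 := by
  rcases Nat.eq_zero_or_pos M with rfl | hM
  · simp
  suffices key : ∀ p, 1 ≤ p → p ≤ M →
      ∑ k ∈ Finset.range p, s k * (x k - y k) ≤ s (p - 1) * ∑ k ∈ Finset.range p, (x k - y k) by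
    have := key M hM le_rfl
    rwa [hDM, mul_zero] at this
  intro p hp hpM
  induction p with
  | zero => exact absurd hp (by decide)
  | succ p ih =>
    rcases Nat.eq_zero_or_pos p with rfl | hp0
    · simp
    · have ih' := ih hp0 (Nat.le_of_succ_le hpM)
      have hsp : s (p - 1) ≤ s p := by
        have := hs (p - 1) (by omega)
        rwa [Nat.sub_add_cancel hp0] at this
      have hDp := hD p (Nat.le_of_succ_le hpM)
      have hmul := mul_le_mul_of_nonneg_right hsp hDp
      rw [Finset.sum_range_succ, Finset.sum_range_succ, Nat.add_sub_cancel, mul_add]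
      linarith

/-- **Karamata's inequality for `φ = -x log x`, positive case.** If `y₀ ≥ y₁ ≥ ⋯ ≥ y_{M-1} > 0`,
`x_k ≥ 0`, the partial sums of `y` are dominated by those of `x` and the totals agree, then
`∑_{k<M} φ(x_k) ≤ ∑_{k<M} φ(y_k)` (Schur concavity of entropy along the dominance order; proof by
the tangent-line inequality at `y_k` and Abel summation). [folklore] -/
theorem sum_negMulLog_le_of_dominated_of_pos (x y : ℕ → ℝ) (M : ℕ) (hx : ∀ k, 0 ≤ x k)
    (hy : ∀ k < M, 0 < y k) (hanti : ∀ k, y (k + 1) ≤ y k)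
    (hdom : ∀ p ≤ M, ∑ k ∈ Finset.range p, y k ≤ ∑ k ∈ Finset.range p, x k)
    (heq : ∑ k ∈ Finset.range M, y k = ∑ k ∈ Finset.range M, x k) :
    ∑ k ∈ Finset.range M, negMulLog (x k) ≤ ∑ k ∈ Finset.range M, negMulLog (y k) := by
  set s : ℕ → ℝ := fun k => -Real.log (y k) - 1 with hs
  have hterm : ∀ k ∈ Finset.range M,
      negMulLog (x k) - negMulLog (y k) ≤ s k * (x k - y k) := by
    intro k hk
    have := negMulLog_le_add_mul_sub (hx k) (hy k (Finset.mem_range.1 hk))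
    simp only [hs]
    linarith
  have hsmono : ∀ k, k + 1 < M → s k ≤ s (k + 1) := by
    intro k hk
    simp only [hs]
    have := Real.log_le_log (hy (k + 1) hk) (hanti k)
    linarith
  have hD : ∀ p ≤ M, 0 ≤ ∑ k ∈ Finset.range p, (x k - y k) := fun p hp => by
    rw [Finset.sum_sub_distrib]
    linarith [hdom p hp]
  have hDM : ∑ k ∈ Finset.range M, (x k - y k) = 0 := by
    rw [Finset.sum_sub_distrib, heq, sub_self]
  have key := sum_mul_sub_nonpos_of_monotone s x y M hsmono hD hDM
  have hsum : ∑ k ∈ Finset.range M, (negMulLog (x k) - negMulLog (y k)) ≤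
      ∑ k ∈ Finset.range M, s k * (x k - y k) := Finset.sum_le_sum hterm
  rw [Finset.sum_sub_distrib] at hsum
  linarith

/-- **Karamata's inequality for `φ = -x log x` (Schur concavity of the entropy function along the
dominance order).** If `y₀ ≥ y₁ ≥ ⋯ ≥ 0`, `x_k ≥ 0`, `∑_{k<p} y_k ≤ ∑_{k<p} x_k` for all
`p ≤ M` with equality at `p = M`, then `∑_{k<M} φ(x_k) ≤ ∑_{k<M} φ(y_k)`. (Reduction to the
positive case by induction on `M`: a vanishing `y_{M}` forces `x_{M} = 0`.) [folklore] -/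
theorem sum_negMulLog_le_of_dominated (x y : ℕ → ℝ) (hx : ∀ k, 0 ≤ x k) (hy : ∀ k, 0 ≤ y k)
    (hanti : ∀ k, y (k + 1) ≤ y k) :
    ∀ M : ℕ, (∀ p ≤ M, ∑ k ∈ Finset.range p, y k ≤ ∑ k ∈ Finset.range p, x k) →
      ∑ k ∈ Finset.range M, y k = ∑ k ∈ Finset.range M, x k →
      ∑ k ∈ Finset.range M, negMulLog (x k) ≤ ∑ k ∈ Finset.range M, negMulLog (y k) := by
  intro M
  induction M with
  | zero => intros; simp
  | succ M ih =>
    intro hdom heq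
    by_cases hyM : 0 < y M
    · refine sum_negMulLog_le_of_dominated_of_pos x y (M + 1) hx (fun k hk => ?_) hanti hdom heq
      exact hyM.trans_le (antitone_nat_of_succ_le hanti (Nat.lt_succ_iff.1 hk))
    · have hyM0 : y M = 0 := le_antisymm (not_lt.1 hyM) (hy M)
      have h1 : ∑ k ∈ Finset.range M, y k ≤ ∑ k ∈ Finset.range M, x k := hdom M (Nat.le_succ M)
      rw [Finset.sum_range_succ, Finset.sum_range_succ, hyM0, add_zero] at heq
      have hxM : x M = 0 := by linarith [hx M]
      have heq' : ∑ k ∈ Finset.range M, y k = ∑ k ∈ Finset.range M, x k := by linarith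
      rw [Finset.sum_range_succ, Finset.sum_range_succ, hxM, hyM0, Real.negMulLog_zero, add_zero,
        add_zero]
      exact ih (fun p hp => hdom p (hp.trans (Nat.le_succ M))) heq'

end Karamata

/-! ## §2 Entropy of the fibre-size distribution of a word -/

section WordEnt

variable {n : ℕ} {α β : Type*} [DecidableEq α] [DecidableEq β]

/-! Throughout, the *word entropy* of `X : Fin n → α` is `ent Finset.univ (fun _ => 1) X`: the
Shannon entropy (in nats) of the distribution of fibre sizes `(#X⁻¹(a)/n)_a`, i.e. the entropy
`H[X]` of `X` as a random variable on the uniform probability space `Fin n`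
(`Literature.Probability.Entropy.FiniteShannon.ent` with unit weights). For the row word
`j ↦ rowOf j` of the canonical tableau of `λ ⊢ n` this is `H(λ̄) · log 2`
(`partitionEntropy_eq_wordEnt_div`). -/

/-- With unit weights the probability of a value is the relative size of its fibre. [folklore] -/
theorem prob_univ_one (X : Fin n → α) (a : α) :
    prob Finset.univ (fun _ => (1 : ℝ)) X a =
      ((Finset.univ.filter fun j => X j = a).card : ℝ) / n := by
  rw [prob_def, mass_def, mass_def, Finset.sum_const, Finset.sum_const, nsmul_eq_mul, nsmul_eq_mul,
    mul_one, mul_one, Finset.card_univ, Fintype.card_fin]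

/-- The word entropy as a sum over any finite set of values containing the range. [folklore] -/
theorem wordEnt_eq_sum (X : Fin n → α) {t : Finset α} (ht : Finset.univ.image X ⊆ t) :
    ent Finset.univ (fun _ => (1 : ℝ)) X =
      ∑ a ∈ t, negMulLog (((Finset.univ.filter fun j => X j = a).card : ℝ) / n) := by
  rw [ent_eq_sum_of_subset ht]
  exact Finset.sum_congr rfl fun a _ => by rw [prob_univ_one]

/-- Subadditivity: `H[(X, Y)] ≤ H[X] + H[Y]`. [folklore] -/
theorem wordEnt_pair_le (X : Fin n → α) (Y : Fin n → β) :
    ent Finset.univ (fun _ => (1 : ℝ)) (fun j => (X j, Y j)) ≤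
      ent Finset.univ (fun _ => (1 : ℝ)) X + ent Finset.univ (fun _ => (1 : ℝ)) Y :=
  ent_pair_le_add fun _ _ => zero_le_one

/-- Invariance under injective relabelling of the values. [folklore] -/
theorem wordEnt_comp_of_injective (X : Fin n → α) {f : α → β} (hf : Function.Injective f) :
    ent Finset.univ (fun _ => (1 : ℝ)) (f ∘ X) = ent Finset.univ (fun _ => (1 : ℝ)) X :=
  ent_comp_of_injOn hf.injOn

/-- Invariance under permutations of the positions. [folklore] -/
theorem wordEnt_comp_perm (X : Fin n → α) (σ : Equiv.Perm (Fin n)) :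
    ent Finset.univ (fun _ => (1 : ℝ)) (X ∘ σ) = ent Finset.univ (fun _ => (1 : ℝ)) X := by
  have himg : Finset.univ.image (X ∘ σ) = Finset.univ.image X := by
    rw [← Finset.image_image, Finset.image_univ_equiv]
  rw [wordEnt_eq_sum (X ∘ σ) himg.le, wordEnt_eq_sum X le_rfl]
  refine Finset.sum_congr rfl fun a _ => ?_
  congr 3
  exact Finset.card_equiv σ fun j => by simp

/-- The first `p` rows of the canonical tableau of `λ` hold `λ₁ + ⋯ + λ_p` entries. [folklore] -/
theorem card_filter_rowOf_lt_eq_sum (lam : Nat.Partition n) (p : ℕ) :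
    (Finset.univ.filter fun j : Fin n => lam.rowOf j < p).card =
      ∑ k ∈ Finset.range p, lam.sortedParts.getD k 0 := by
  induction p with
  | zero => simp
  | succ p ih =>
    rw [Finset.sum_range_succ, ← ih, ← card_filter_rowOf_eq lam p, ← Finset.card_union_of_disjoint]
    · congr 1
      ext j
      simp only [Finset.mem_filter, Finset.mem_univ, true_and, Finset.mem_union]
      omega
    · rw [Finset.disjoint_filter]
      intro j _ h
      omega

/-- `H(λ̄) = H[rowOf] / log 2`: the partition entropy (in bits) of `λ ⊢ n` is the word entropy of
the row word of its canonical tableau. [folklore] -/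
theorem partitionEntropy_eq_wordEnt_div (lam : Nat.Partition n) :
    partitionEntropy lam = ent Finset.univ (fun _ => (1 : ℝ)) lam.rowOf / Real.log 2 := by
  rw [partitionEntropy_def]
  congr 1
  have ht : Finset.univ.image lam.rowOf ⊆ Finset.range lam.sortedParts.length := by
    intro a ha
    obtain ⟨j, -, rfl⟩ := Finset.mem_image.1 ha
    exact Finset.mem_range.2 (lam.rowOf_lt_length j)
  rw [wordEnt_eq_sum lam.rowOf ht]
  simp only [card_filter_rowOf_eq]
  set g : ℕ → ℝ := fun p => negMulLog ((p : ℝ) / n) with hg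
  have h1 : (lam.parts.map g).sum = (lam.sortedParts.map g).sum := by
    rw [Nat.Partition.sortedParts, ← Multiset.sum_coe, ← Multiset.map_coe, Multiset.sort_eq]
  rw [h1, ← List.ofFn_getElem_eq_map, List.sum_ofFn,
    ← Fin.sum_univ_eq_sum_range (fun k => g (lam.sortedParts.getD k 0))]
  refine Finset.sum_congr rfl fun k _ => ?_
  rw [List.getD_eq_getElem _ _ k.isLt]

/-- **Schur concavity along dominance, for words.** If a word `X : Fin n → α` is column-strict for
`λ ⊢ n` (it takes distinct values on distinct positions of each column of the canonical tableau
of `λ`), then `H(λ̄) · log 2 = H[rowOf_λ] ≤ H[X]`: the sorted fibre sizes of `X` are dominated by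
`λ` (`lowCount_le_of_isColStrict`: the `p` largest fibres hold at most `λ₁ + ⋯ + λ_p` positions),
and the entropy function is Schur concave (`sum_negMulLog_le_of_dominated`). [folklore] -/
theorem wordEnt_rowOf_le_of_colStrict (lam : Nat.Partition n) (X : Fin n → α)
    (hX : ∀ ⦃j j' : Fin n⦄, lam.colOf j = lam.colOf j' → X j = X j' → j = j') :
    ent Finset.univ (fun _ => (1 : ℝ)) lam.rowOf ≤ ent Finset.univ (fun _ => (1 : ℝ)) X := by
  classical
  -- the values of `X`, sorted by decreasing fibre size
  set t : Finset α := Finset.univ.image X with ht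
  set m : ℕ := t.card with hm
  set size : α → ℕ := fun a => (Finset.univ.filter fun j => X j = a).card with hsize
  let e₀ : Fin m ≃ t := t.equivFin.symm
  let f₀ : Fin m → ℕᵒᵈ := fun k => OrderDual.toDual (size (e₀ k : α))
  let τ : Equiv.Perm (Fin m) := Tuple.sort f₀
  have hmono : Monotone (f₀ ∘ τ) := Tuple.monotone_sort f₀
  let e : Fin m → α := fun k => (e₀ (τ k) : α)
  have hanti' : ∀ {k k' : Fin m}, k ≤ k' → size (e k') ≤ size (e k) := fun {k k'} hkk' =>
    OrderDual.toDual_le_toDual.1 (hmono hkk')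
  -- the sorted fibre sizes, padded by zeros
  let c : ℕ → ℕ := fun k => if h : k < m then size (e ⟨k, h⟩) else 0
  have hc_of_lt : ∀ {k : ℕ} (h : k < m), c k = size (e ⟨k, h⟩) := fun h => dif_pos h
  have hc_of_le : ∀ {k : ℕ}, m ≤ k → c k = 0 := fun h => dif_neg (not_lt.2 h)
  -- the word of fibre ranks is column-strict, with partial letter counts the partial sums of `c`
  have hmem : ∀ j, X j ∈ t := fun j => Finset.mem_image_of_mem X (Finset.mem_univ j)
  let I : Fin n → Fin m := fun j => τ.symm (e₀.symm ⟨X j, hmem j⟩)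
  have hI_iff : ∀ (j : Fin n) (k : Fin m), I j = k ↔ X j = e k := by
    intro j k
    constructor
    · intro h
      have : e₀ (τ (I j)) = ⟨X j, hmem j⟩ := by simp [I]
      rw [h] at this
      exact congrArg Subtype.val this.symm
    · intro h
      have h' : (⟨X j, hmem j⟩ : t) = e₀ (τ k) := Subtype.ext h
      simp [I, h']
  have hI : IsColStrict lam I := by
    intro j j' hcol hIjj'
    apply hX hcol
    rw [(hI_iff j (I j')).1 hIjj', ← (hI_iff j' (I j')).1 rfl]
  have hcount : ∀ p, (Finset.univ.filter fun j => ((I j : Fin m) : ℕ) = p).card = c p := by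
    intro p
    by_cases hp : p < m
    · rw [hc_of_lt hp, hsize]
      congr 1
      ext j
      simp only [Finset.mem_filter, Finset.mem_univ, true_and]
      rw [← hI_iff j ⟨p, hp⟩, Fin.ext_iff]
    · rw [hc_of_le (not_lt.1 hp)]
      refine Finset.card_eq_zero.2 (Finset.filter_eq_empty_iff.2 fun j _ h => hp ?_)
      rw [← h]
      exact (I j).isLt
  have hlow : ∀ p, lowCount I p = ∑ k ∈ Finset.range p, c k := by
    intro p
    induction p with
    | zero => simp [lowCount]
    | succ p ih => rw [lowCount_succ, ih, hcount, Finset.sum_range_succ]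
  -- everything is exhausted after `M = m + ℓ(λ)` steps
  set M : ℕ := m + lam.sortedParts.length with hM
  have hlowM : lowCount I M = n := by
    unfold lowCount
    rw [Finset.filter_true_of_mem fun j _ => (I j).isLt.trans_le (Nat.le_add_right _ _),
      Finset.card_univ, Fintype.card_fin]
  have hrowM : (Finset.univ.filter fun j : Fin n => lam.rowOf j < M).card = n := by
    rw [Finset.filter_true_of_mem fun j _ => (lam.rowOf_lt_length j).trans_le (Nat.le_add_left _ _),
      Finset.card_univ, Fintype.card_fin]
  -- the two sequences compared by Karamata's inequality
  let x : ℕ → ℝ := fun k => (lam.sortedParts.getD k 0 : ℝ) / n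
  let y : ℕ → ℝ := fun k => (c k : ℝ) / n
  have hx : ∀ k, 0 ≤ x k := fun k => by positivity
  have hy : ∀ k, 0 ≤ y k := fun k => by positivity
  have hanti : ∀ k, y (k + 1) ≤ y k := by
    intro k
    refine div_le_div_of_nonneg_right ?_ (Nat.cast_nonneg n)
    rw [Nat.cast_le]
    by_cases hk : k + 1 < m
    · rw [hc_of_lt hk, hc_of_lt (Nat.lt_of_succ_lt hk)]
      exact hanti' (Fin.mk_le_mk.2 (Nat.le_succ k))
    · rw [hc_of_le (not_lt.1 hk)]
      exact Nat.zero_le _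
  have hsumy : ∀ p, ∑ k ∈ Finset.range p, y k = (lowCount I p : ℝ) / n := by
    intro p
    rw [hlow, Nat.cast_sum, Finset.sum_div]
  have hsumx : ∀ p, ∑ k ∈ Finset.range p, x k =
      ((Finset.univ.filter fun j : Fin n => lam.rowOf j < p).card : ℝ) / n := by
    intro p
    rw [card_filter_rowOf_lt_eq_sum, Nat.cast_sum, Finset.sum_div]
  have hdom : ∀ p ≤ M, ∑ k ∈ Finset.range p, y k ≤ ∑ k ∈ Finset.range p, x k := by
    intro p _
    rw [hsumy, hsumx]
    exact div_le_div_of_nonneg_right (Nat.cast_le.2 (lowCount_le_of_isColStrict lam hI p))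
      (Nat.cast_nonneg n)
  have heq : ∑ k ∈ Finset.range M, y k = ∑ k ∈ Finset.range M, x k := by
    rw [hsumy, hsumx, hlowM, hrowM]
  have kar := sum_negMulLog_le_of_dominated x y hx hy hanti M hdom heq
  -- identify the two sides with the entropies
  have hleft : ent Finset.univ (fun _ => (1 : ℝ)) lam.rowOf =
      ∑ k ∈ Finset.range M, negMulLog (x k) := by
    have hsub : Finset.univ.image lam.rowOf ⊆ Finset.range M := by
      intro a ha
      obtain ⟨j, -, rfl⟩ := Finset.mem_image.1 ha
      exact Finset.mem_range.2 ((lam.rowOf_lt_length j).trans_le (Nat.le_add_left _ _))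
    rw [wordEnt_eq_sum lam.rowOf hsub]
    simp only [card_filter_rowOf_eq, x]
  have hright : ent Finset.univ (fun _ => (1 : ℝ)) X = ∑ k ∈ Finset.range M, negMulLog (y k) := by
    rw [wordEnt_eq_sum X le_rfl, ← Finset.sum_coe_sort t, ← Equiv.sum_comp (τ.trans e₀)]
    have h2 : ∑ k ∈ Finset.range M, negMulLog (y k) = ∑ k ∈ Finset.range m, negMulLog (y k) := by
      symm
      refine Finset.sum_subset (Finset.range_subset_range.2 (Nat.le_add_right _ _))
        fun k _ hkm => ?_
      have : m ≤ k := not_lt.1 fun h => hkm (Finset.mem_range.2 h)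
      simp only [y, hc_of_le this, Nat.cast_zero, zero_div, Real.negMulLog_zero]
    rw [h2, ← Fin.sum_univ_eq_sum_range (fun k => negMulLog (y k))]
    refine Finset.sum_congr rfl fun k _ => ?_
    simp only [y, hc_of_lt k.isLt, Fin.eta, Equiv.trans_apply, e, hsize]
  rw [hleft, hright]
  exact kar

end WordEnt

/-! ## §3 Kronecker coefficients and contingency tables: `g_{λ,μ,ν} ≠ 0` forces a column-strict
block word -/

section Specht

variable {n : ℕ}

/-- The row symmetrizer absorbs row permutations on the left: `p · a_μ = a_μ` for `p ∈ R_μ`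
(companion of `rowSymmetrizer_mul_of`; Fulton–Harris, Lemma 4.21 (1)). [folklore] -/
theorem of_mul_rowSymmetrizer {μ : Nat.Partition n} {p : Equiv.Perm (Fin n)}
    (hp : p ∈ rowStabilizer μ) :
    MonoidAlgebra.of ℂ _ p * rowSymmetrizer ℂ μ = rowSymmetrizer ℂ μ := by
  unfold rowSymmetrizer
  rw [Finset.mul_sum]
  refine Finset.sum_equiv (Equiv.mulLeft p) (fun σ => ?_) (fun σ _ => ?_)
  · simp only [Equiv.coe_mulLeft, Set.mem_toFinset, SetLike.mem_coe]
    exact ⟨fun h => mul_mem hp h, fun h => by simpa using mul_mem (inv_mem hp) h⟩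
  · rw [Equiv.coe_mulLeft, map_mul]

/-- `p · c_μ = c_μ` for `p ∈ R_μ`: the Young symmetrizer `c_μ = a_μ b_μ` is fixed under left
multiplication by the row group. [folklore] -/
theorem of_mul_youngSymmetrizer {μ : Nat.Partition n} {p : Equiv.Perm (Fin n)}
    (hp : p ∈ rowStabilizer μ) :
    MonoidAlgebra.of ℂ _ p * youngSymmetrizer ℂ μ = youngSymmetrizer ℂ μ := by
  rw [youngSymmetrizer, ← mul_assoc, of_mul_rowSymmetrizer hp]

/-- The generator `σ · c_μ` of `S^μ` is fixed by the conjugate row group `σ R_μ σ⁻¹`: if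
`v = σ c_μ` and `σ⁻¹ h σ ∈ R_μ` then `h · v = v`. [folklore] -/
theorem spechtRep_eq_self_of_conj_mem_rowStabilizer {μ : Nat.Partition n} {h σ : Equiv.Perm (Fin n)}
    (hh : σ⁻¹ * h * σ ∈ rowStabilizer μ) {v : spechtIdeal ℂ μ}
    (hv : (v : MonoidAlgebra ℂ (Equiv.Perm (Fin n))) =
      MonoidAlgebra.of ℂ _ σ * youngSymmetrizer ℂ μ) :
    spechtRep ℂ μ h v = v := by
  apply Subtype.ext
  rw [spechtRep_apply, hv, ← mul_assoc]
  have : MonoidAlgebra.of ℂ _ h * MonoidAlgebra.of ℂ _ σ =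
      MonoidAlgebra.of ℂ _ σ * MonoidAlgebra.of ℂ _ (σ⁻¹ * h * σ) := by
    rw [← map_mul, ← map_mul, ← mul_assoc, ← mul_assoc, mul_inv_cancel, one_mul]
  rw [this, mul_assoc, of_mul_youngSymmetrizer hh]

/-- An intertwining map `S^μ ⊗ S^ν → W` vanishing on all pure tensors of generators
`(σ c_μ) ⊗ (τ c_ν)` vanishes: `S^μ = ℂ[S_n] c_μ` is spanned over `ℂ` by the `σ c_μ`, so the pure
tensors of generators span `S^μ ⊗ S^ν`. [folklore] -/
theorem intertwiningMap_tprod_eq_zero {μ ν : Nat.Partition n} {W : Type*} [AddCommGroup W]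
    [Module ℂ W] {ρ : Representation ℂ (Equiv.Perm (Fin n)) W}
    (f : ((spechtRep ℂ μ).tprod (spechtRep ℂ ν)).IntertwiningMap ρ)
    (hf : ∀ (v : spechtIdeal ℂ μ) (w : spechtIdeal ℂ ν) (σ τ : Equiv.Perm (Fin n)),
      (v : MonoidAlgebra ℂ (Equiv.Perm (Fin n))) = MonoidAlgebra.of ℂ _ σ * youngSymmetrizer ℂ μ →
      (w : MonoidAlgebra ℂ (Equiv.Perm (Fin n))) = MonoidAlgebra.of ℂ _ τ * youngSymmetrizer ℂ ν →
      f (v ⊗ₜ[ℂ] w) = 0) :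
    f = 0 := by
  -- every `v ∈ S^μ` is `z c_μ`; induct on `z` (and likewise for `w`)
  have inner : ∀ (v : spechtIdeal ℂ μ) (σ : Equiv.Perm (Fin n)),
      (v : MonoidAlgebra ℂ (Equiv.Perm (Fin n))) = MonoidAlgebra.of ℂ _ σ * youngSymmetrizer ℂ μ →
      ∀ (z' : MonoidAlgebra ℂ (Equiv.Perm (Fin n))) (w : spechtIdeal ℂ ν),
        (w : MonoidAlgebra ℂ (Equiv.Perm (Fin n))) = z' * youngSymmetrizer ℂ ν →
          f (v ⊗ₜ[ℂ] w) = 0 := by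
    intro v σ hv z'
    induction z' using MonoidAlgebra.induction_on with
    | hM τ => exact fun w hw => hf v w σ τ hv hw
    | hadd p q hp hq =>
      intro w hw
      let w₁ : spechtIdeal ℂ ν :=
        ⟨p * youngSymmetrizer ℂ ν, Ideal.mul_mem_left _ p (youngSymmetrizer_mem_spechtIdeal ℂ ν)⟩
      let w₂ : spechtIdeal ℂ ν :=
        ⟨q * youngSymmetrizer ℂ ν, Ideal.mul_mem_left _ q (youngSymmetrizer_mem_spechtIdeal ℂ ν)⟩
      have hw' : w = w₁ + w₂ := Subtype.ext (by rw [hw, Submodule.coe_add, add_mul])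
      rw [hw', TensorProduct.tmul_add, map_add, hp w₁ rfl, hq w₂ rfl, add_zero]
    | hsmul r p hp =>
      intro w hw
      let w₁ : spechtIdeal ℂ ν :=
        ⟨p * youngSymmetrizer ℂ ν, Ideal.mul_mem_left _ p (youngSymmetrizer_mem_spechtIdeal ℂ ν)⟩
      have hw' : w = r • w₁ := by
        apply Subtype.ext
        change (w : MonoidAlgebra ℂ (Equiv.Perm (Fin n))) = r • (p * youngSymmetrizer ℂ ν)
        rw [hw, smul_mul_assoc]
      rw [hw', TensorProduct.tmul_smul, map_smul, hp w₁ rfl, smul_zero]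
  have outer : ∀ (z : MonoidAlgebra ℂ (Equiv.Perm (Fin n))) (v : spechtIdeal ℂ μ),
      (v : MonoidAlgebra ℂ (Equiv.Perm (Fin n))) = z * youngSymmetrizer ℂ μ →
      ∀ w : spechtIdeal ℂ ν, f (v ⊗ₜ[ℂ] w) = 0 := by
    intro z
    induction z using MonoidAlgebra.induction_on with
    | hM σ =>
      intro v hv w
      obtain ⟨z', hz'⟩ := Ideal.mem_span_singleton'.mp w.2
      exact inner v σ hv z' w hz'.symm
    | hadd p q hp hq =>
      intro v hv w
      let v₁ : spechtIdeal ℂ μ :=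
        ⟨p * youngSymmetrizer ℂ μ, Ideal.mul_mem_left _ p (youngSymmetrizer_mem_spechtIdeal ℂ μ)⟩
      let v₂ : spechtIdeal ℂ μ :=
        ⟨q * youngSymmetrizer ℂ μ, Ideal.mul_mem_left _ q (youngSymmetrizer_mem_spechtIdeal ℂ μ)⟩
      have hv' : v = v₁ + v₂ := Subtype.ext (by rw [hv, Submodule.coe_add, add_mul])
      rw [hv', TensorProduct.add_tmul, map_add, hp v₁ rfl, hq v₂ rfl, add_zero]
    | hsmul r p hp =>
      intro v hv w
      let v₁ : spechtIdeal ℂ μ :=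
        ⟨p * youngSymmetrizer ℂ μ, Ideal.mul_mem_left _ p (youngSymmetrizer_mem_spechtIdeal ℂ μ)⟩
      have hv' : v = r • v₁ := by
        apply Subtype.ext
        change (v : MonoidAlgebra ℂ (Equiv.Perm (Fin n))) = r • (p * youngSymmetrizer ℂ μ)
        rw [hv, smul_mul_assoc]
      rw [hv', ← TensorProduct.smul_tmul', map_smul, hp v₁ rfl, smul_zero]
  apply Representation.IntertwiningMap.ext
  refine TensorProduct.ext' fun v w => ?_
  obtain ⟨z, hz⟩ := Ideal.mem_span_singleton'.mp v.2
  rw [Representation.IntertwiningMap.toLinearMap_apply, outer z v hz.symm w,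
    Representation.IntertwiningMap.zero_toLinearMap, LinearMap.zero_apply]

/-- **Nonvanishing Kronecker coefficient, concretely**: if
`g_{λ,μ,ν} = dim Hom_{S_n}(S^μ ⊗ S^ν, S^λ)` is nonzero, some intertwining map `f : S^μ ⊗ S^ν → S^λ`
is nonzero on some pure tensor of generators `(σ c_μ) ⊗ (τ c_ν)`. [folklore] -/
theorem exists_intertwiningMap_tmul_ne_zero {lam mu nu : Nat.Partition n}
    (h : kroneckerCoeff ℂ mu nu lam ≠ 0) :
    ∃ (f : ((spechtRep ℂ mu).tprod (spechtRep ℂ nu)).IntertwiningMap (spechtRep ℂ lam))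
      (v : spechtIdeal ℂ mu) (w : spechtIdeal ℂ nu) (σ τ : Equiv.Perm (Fin n)),
      (v : MonoidAlgebra ℂ (Equiv.Perm (Fin n))) = MonoidAlgebra.of ℂ _ σ * youngSymmetrizer ℂ mu ∧
      (w : MonoidAlgebra ℂ (Equiv.Perm (Fin n))) = MonoidAlgebra.of ℂ _ τ * youngSymmetrizer ℂ nu ∧
      f (v ⊗ₜ[ℂ] w) ≠ 0 := by
  haveI : Nontrivial
      (((spechtRep ℂ mu).tprod (spechtRep ℂ nu)).IntertwiningMap (spechtRep ℂ lam)) :=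
    Module.nontrivial_of_finrank_pos (R := ℂ) (Nat.pos_of_ne_zero h)
  obtain ⟨f, hf⟩ := exists_ne
    (0 : ((spechtRep ℂ mu).tprod (spechtRep ℂ nu)).IntertwiningMap (spechtRep ℂ lam))
  by_contra hall
  push Not at hall
  exact hf (intertwiningMap_tprod_eq_zero f fun v w σ τ hv hw => hall f v w σ τ hv hw)

/-- A nonzero element of the group algebra has a nonzero coefficient. [folklore] -/
theorem exists_coeff_ne_zero_of_ne_zero {v : MonoidAlgebra ℂ (Equiv.Perm (Fin n))} (hv : v ≠ 0) :
    ∃ g, v.coeff g ≠ 0 := by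
  by_contra h
  push Not at h
  apply hv
  rw [← MonoidAlgebra.coeff_eq_zero]
  ext g
  exact h g

/-- **The sign trick** (cf. Fulton–Harris, proof of Lemma 4.23): let `v ∈ S^λ = ℂ[S_n] a_λ b_λ`
have a nonzero coefficient at `g`, and let `v` be fixed under left multiplication by a
transposition `(x y)`. Then the positions `g⁻¹ x`, `g⁻¹ y` lie in different columns of the
canonical tableau of `λ`: otherwise `t' = g⁻¹ (x y) g ∈ C_λ`, `v t' = -v`, and comparing
coefficients at `(x y) g = g t'` gives `v_g = -v_g`. [folklore] -/
theorem colOf_ne_of_of_swap_mul_eq {lam : Nat.Partition n}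
    {v : MonoidAlgebra ℂ (Equiv.Perm (Fin n))} (hv : v ∈ spechtIdeal ℂ lam)
    {g : Equiv.Perm (Fin n)} (hg : v.coeff g ≠ 0) {x y : Fin n} (hxy : x ≠ y)
    (hfix : MonoidAlgebra.of ℂ _ (Equiv.swap x y) * v = v) :
    lam.colOf (g⁻¹ x) ≠ lam.colOf (g⁻¹ y) := by
  intro hcol
  obtain ⟨z, rfl⟩ := Ideal.mem_span_singleton'.mp hv
  set t' : Equiv.Perm (Fin n) := Equiv.swap (g⁻¹ x) (g⁻¹ y) with ht'def
  have ht' : t' ∈ colStabilizer lam := swap_mem_colStabilizer lam hcol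
  have hsgn : Equiv.Perm.sign t' = -1 := Equiv.Perm.sign_swap (g⁻¹.injective.ne hxy)
  -- right sign-absorption: `(z c_λ) t' = -(z c_λ)`
  have hright : z * youngSymmetrizer ℂ lam * MonoidAlgebra.of ℂ _ t' =
      -(z * youngSymmetrizer ℂ lam) := by
    rw [youngSymmetrizer, ← mul_assoc, mul_assoc _ _ (MonoidAlgebra.of ℂ _ t'),
      colAntisymmetrizer_mul_of ht', hsgn, Units.val_neg, Units.val_one, Int.cast_neg, Int.cast_one,
      mul_smul_comm, neg_smul, one_smul]
  -- `(x y) g = g t'`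
  have hconj : Equiv.swap x y * g = g * t' := by
    rw [ht'def, Equiv.swap_mul_eq_mul_swap]
  -- the coefficient of `v` at `(x y) g`, computed in two ways
  have h1 : (z * youngSymmetrizer ℂ lam).coeff (Equiv.swap x y * g) =
      (z * youngSymmetrizer ℂ lam).coeff g := by
    conv_lhs => rw [← hfix]
    rw [MonoidAlgebra.of_apply, MonoidAlgebra.coeff_single_mul_mul, one_mul]
  have h2 : (z * youngSymmetrizer ℂ lam).coeff (Equiv.swap x y * g) =
      -(z * youngSymmetrizer ℂ lam).coeff g := by
    have := congrArg (fun w => MonoidAlgebra.coeff w g) hright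
    simp only [MonoidAlgebra.coeff_neg, Finsupp.neg_apply, MonoidAlgebra.of_apply,
      MonoidAlgebra.coeff_mul_single_apply, mul_one] at this
    have hinv : t'⁻¹ = t' := Equiv.swap_inv _ _
    rw [hinv, ← hconj] at this
    exact this
  have h3 : (z * youngSymmetrizer ℂ lam).coeff g = 0 := by
    have h := h1.symm.trans h2
    have h' : (2 : ℂ) * (z * youngSymmetrizer ℂ lam).coeff g = 0 := by linear_combination h
    exact (mul_eq_zero.1 h').resolve_left two_ne_zero
  exact hg h3

/-- **`g_{λ,μ,ν} ≠ 0` forces a column-strict block word.** If an intertwining map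
`f : S^μ ⊗ S^ν → S^λ` is nonzero on `v ⊗ w = (σ c_μ) ⊗ (τ c_ν)`, then for some `g ∈ S_n` the word
of blocks `j ↦ (row of σ⁻¹(g j) in T_μ, row of τ⁻¹(g j) in T_ν)` is column-strict for `λ`: the
image `f(v ⊗ w) ∈ S^λ` is fixed by the Young subgroup `σ R_μ σ⁻¹ ∩ τ R_ν τ⁻¹` of the common
refinement of the two row partitions, `g` is any permutation in its support, and the sign trick
`colOf_ne_of_of_swap_mul_eq` applies to every transposition of that Young subgroup. This is the
`S_n`-side of the classical necessary condition "a constituent `[λ]` of `[μ] ⊗ [ν]` is a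
constituent of some Young permutation module `M^A`, `A` a contingency table with margins `μ, ν`,
hence `λ ⊵ A`". [folklore] -/
theorem exists_colStrict_blockWord {lam mu nu : Nat.Partition n}
    (f : ((spechtRep ℂ mu).tprod (spechtRep ℂ nu)).IntertwiningMap (spechtRep ℂ lam))
    {v : spechtIdeal ℂ mu} {w : spechtIdeal ℂ nu} {σ τ : Equiv.Perm (Fin n)}
    (hv : (v : MonoidAlgebra ℂ (Equiv.Perm (Fin n))) =
      MonoidAlgebra.of ℂ _ σ * youngSymmetrizer ℂ mu)
    (hw : (w : MonoidAlgebra ℂ (Equiv.Perm (Fin n))) =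
      MonoidAlgebra.of ℂ _ τ * youngSymmetrizer ℂ nu)
    (hf : f (v ⊗ₜ[ℂ] w) ≠ 0) :
    ∃ g : Equiv.Perm (Fin n), ∀ ⦃j j' : Fin n⦄, lam.colOf j = lam.colOf j' →
      mu.rowOf (σ⁻¹ (g j)) = mu.rowOf (σ⁻¹ (g j')) → nu.rowOf (τ⁻¹ (g j)) = nu.rowOf (τ⁻¹ (g j')) →
        j = j' := by
  have hfv : ((f (v ⊗ₜ[ℂ] w) : spechtIdeal ℂ lam) : MonoidAlgebra ℂ (Equiv.Perm (Fin n))) ≠ 0 :=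
    fun h => hf (Subtype.ext h)
  obtain ⟨g, hg⟩ := exists_coeff_ne_zero_of_ne_zero hfv
  refine ⟨g, fun j j' hcol hrμ hrν => ?_⟩
  by_contra hjj'
  have hxy : g j ≠ g j' := g.injective.ne hjj'
  -- the transposition `(g j, g j')` lies in `σ R_μ σ⁻¹ ∩ τ R_ν τ⁻¹`
  have hmu : σ⁻¹ * Equiv.swap (g j) (g j') * σ ∈ rowStabilizer mu := by
    rw [mul_assoc, Equiv.swap_mul_eq_mul_swap, ← mul_assoc, inv_mul_cancel, one_mul]
    exact swap_mem_rowStabilizer mu hrμ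
  have hnu : τ⁻¹ * Equiv.swap (g j) (g j') * τ ∈ rowStabilizer nu := by
    rw [mul_assoc, Equiv.swap_mul_eq_mul_swap, ← mul_assoc, inv_mul_cancel, one_mul]
    exact swap_mem_rowStabilizer nu hrν
  -- hence it fixes `v ⊗ w`, and (by equivariance) the vector `f(v ⊗ w)`
  have hfix : MonoidAlgebra.of ℂ _ (Equiv.swap (g j) (g j')) *
      ((f (v ⊗ₜ[ℂ] w) : spechtIdeal ℂ lam) : MonoidAlgebra ℂ (Equiv.Perm (Fin n))) =
      f (v ⊗ₜ[ℂ] w) := by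
    have := Representation.IntertwiningMap.isIntertwining _ _ f (Equiv.swap (g j) (g j'))
      (v ⊗ₜ[ℂ] w)
    rw [Representation.tprod_apply, TensorProduct.map_tmul,
      spechtRep_eq_self_of_conj_mem_rowStabilizer hmu hv,
      spechtRep_eq_self_of_conj_mem_rowStabilizer hnu hw] at this
    have h' := congrArg Subtype.val this
    rw [spechtRep_apply] at h'
    exact h'.symm
  have key := colOf_ne_of_of_swap_mul_eq (f _).2 hg hxy hfix
  simp only [Equiv.Perm.coe_inv, Equiv.symm_apply_apply] at key
  exact key hcol

end Specht

/-! ## §4 The discharge -/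

/-- **Discharge of CVZ Lemma 3.10.1** (Christandl–Vrana–Zuiddam, J. Amer. Math. Soc. 36 (2023) =
arXiv:1709.07851v3, Lemma 3.10, first item, p. 13: "Let `λ, μ, ν` be integer partitions. If
`g_{λ,μ,ν}` is nonzero, then `H(λ̄) ≤ H(μ̄) + H(ν̄)`"; attributed there to Christandl–Mitchison,
Comm. Math. Phys. 261 (2006)). The printed proof runs through the semigroup property of the
Kronecker coefficients (Rem. 3.9) and the hook-length dimension bounds (Rem. 3.7) as `N → ∞`; the
proof given here is the elementary weight argument instead:

* `exists_intertwiningMap_tmul_ne_zero`, `exists_colStrict_blockWord`: a nonzero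
  `f ∈ Hom_{S_n}(S^μ ⊗ S^ν, S^λ)` is nonzero on some `(σ c_μ) ⊗ (τ c_ν)`, whose image in
  `S^λ = ℂ[S_n] a_λ b_λ` is fixed by the Young subgroup of the common refinement `A` (a contingency
  table with row margins `μ` and column margins `ν`) of the row partitions of `σ T_μ` and `τ T_ν`;
  the sign trick of Fulton–Harris Lemma 4.23 then makes the block word column-strict for `λ`,
  i.e. `λ ⊵ A` in the dominance order (`lowCount_le_of_isColStrict`);
* `wordEnt_rowOf_le_of_colStrict`: Schur concavity of the Shannon entropy along dominance
  (Karamata's inequality for `-x log x`, `sum_negMulLog_le_of_dominated`): `H(λ̄) ≤ H(Ā)`;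
* subadditivity of the Shannon entropy
  (`Literature.Probability.Entropy.FiniteShannon.ent_pair_le_add`): `H(Ā) ≤ H(μ̄) + H(ν̄)`, the
  margins of `A` being `μ` and `ν`.
[cite: ChristandlVranaZuiddam2023, Lemma 3.10.1] -/
theorem ChristandlVranaZuiddam2023_entropy_le_of_kroneckerCoeff_holds :
    ChristandlVranaZuiddam2023_entropy_le_of_kroneckerCoeff := by
  intro n lam mu nu h
  obtain ⟨f, v, w, σ, τ, hv, hw, hf⟩ := exists_intertwiningMap_tmul_ne_zero h
  obtain ⟨g, hg⟩ := exists_colStrict_blockWord f hv hw hf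
  have hcs : ∀ ⦃j j' : Fin n⦄, lam.colOf j = lam.colOf j' →
      (fun i => ((mu.rowOf ∘ ⇑(σ⁻¹ * g)) i, (nu.rowOf ∘ ⇑(τ⁻¹ * g)) i)) j =
        (fun i => ((mu.rowOf ∘ ⇑(σ⁻¹ * g)) i, (nu.rowOf ∘ ⇑(τ⁻¹ * g)) i)) j' → j = j' := by
    intro j j' hcol hXY
    simp only [Function.comp_apply, Equiv.Perm.coe_mul, Prod.mk.injEq] at hXY
    exact hg hcol hXY.1 hXY.2
  have h1 := wordEnt_rowOf_le_of_colStrict lam _ hcs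
  have h2 := wordEnt_pair_le (mu.rowOf ∘ ⇑(σ⁻¹ * g)) (nu.rowOf ∘ ⇑(τ⁻¹ * g))
  rw [wordEnt_comp_perm, wordEnt_comp_perm] at h2
  rw [partitionEntropy_eq_wordEnt_div, partitionEntropy_eq_wordEnt_div,
    partitionEntropy_eq_wordEnt_div, ← add_div]
  exact div_le_div_of_nonneg_right (h1.trans h2) (Real.log_nonneg one_le_two)

end Literature.Computability.AlgebraicComplexity

end
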